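import Literature.Analysis.Complex.KoebeDistortion
import Literature.Analysis.Complex.KoebeQuarterProofs
import HarnessLib

/-!
# Conformal radius deficit of a boundary perturbation, by Koebe distortion (proofs only)

Topic `Analysis/Complex`; theorems only, a sequel of `ConformalRadius` (the extremal conformal
radius `𝔯(K)` of the component of `0` in `𝔻 ∖ K`), `KoebeDistortion` (Pommerenke (1992),
Thm. 1.3) and `KoebeQuarterProofs` (`koebeQuarter_holds`, Lawler (2005), Thm. 3.17).

Motivation: the proof of Lemma 2.3 of Lawler–Schramm–Werner, *One-arm exponent for critical 2D
percolation*, Electron. J. Probab. **7** (2002), paper no. 2 (p. 7) bounds the change of the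
conformal radius when the hull `Q(θ)` grows to `Q(2π) = Q(θ) ∪ Q'` by a set `Q'` of small
diameter near the boundary point `1`:
`min{log 𝔯(θ) - log 𝔯(2π), 1} ≤ c₂ c₁⁴ (diam Q')²`, through the harmonic-measure estimate (2.15)
and the conformal invariance of harmonic measure. Mathlib has no harmonic measure. This file
proves a weaker but harmonic-measure-free deficit bound with exponent `1/2` in place of `2`,
which is all that the identification theorem of the tree
(`Literature.Probability.Percolation.lswHit_two_pi_eq_measureReal_of_renewal`,
`OneArmTraceIdentification.lean`: flatness to order `o((2π - θ)^{1/3})` suffices) asks of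
Lemma 2.3:

* `ball_subset_image_of_norm_lt_one` — **Koebe's quarter theorem at an arbitrary point**: for `f`
  holomorphic and injective on `𝔻` and `|z| < 1`, `B(f(z), |f'(z)| (1 - |z|)/4) ⊆ f(𝔻)`
  (Lawler (2005), Thm. 3.17 applied to `w ↦ f(z + (1 - |z|) w)`; cf. his Cor. 3.19);
* `mul_sq_le_dist_of_notMem_image` — hence, with the distortion theorem
  `|f'(z)| ≥ |f'(0)| (1 - |z|)/(1 + |z|)³ ≥ |f'(0)| (1 - |z|)/8` (Pommerenke (1992), Thm. 1.3),
  every value `ζ ∉ f(𝔻)` satisfies `|f(z) - ζ| ≥ |f'(0)| (1 - |z|)²/32`;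
* `IsUnivalentInto.rescale_union` — so if `φ : 𝔻 → 𝔻 ∖ K` is admissible for `K` (univalent,
  `φ(0) = 0`), `|ζ| ≥ 1`, `K' ⊆ B̄(ζ, r)` and `32 r ≤ |φ'(0)| s²`, `0 ≤ s < 1`, then
  `w ↦ φ((1 - s) w)` is admissible for `K ∪ K'` (the points `|z| < 1 - s` stay at distance `> r`
  from `ζ ∉ φ(𝔻) ⊆ 𝔻`), with derivative `(1 - s) φ'(0)` at `0` (`norm_deriv_rescale`);
* `IsUnivalentInto.sub_sqrt_le_conformalRadius_union`, `sub_sqrt_le_conformalRadius_union` —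
  **the deficit bound**: for `|ζ| ≥ 1`, `r ≥ 0` and `K' ⊆ B̄(ζ, r)`,
  `𝔯(K ∪ K') ≥ 𝔯(K) - √(32 r 𝔯(K))` (take `s = √(32 r/|φ'(0)|)` and pass to the supremum over
  admissible `φ`, `exists_isUnivalentInto_of_lt`);
* `one_sub_sqrt_mul_le_conformalRadius_union` — ratio form: if moreover `0 < ρ₀ ≤ 𝔯(K)` then
  `𝔯(K ∪ K') ≥ (1 - √(32 r/ρ₀)) 𝔯(K)`;
* `log_conformalRadius_sub_log_union_le`, `min_log_conformalRadius_sub_log_union_le` —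
  logarithmic forms: `log 𝔯(K) - log 𝔯(K ∪ K') ≤ 2 √(32 r/ρ₀)` when `32 r/ρ₀ ≤ 1/4`, and
  `min{log 𝔯(K) - log 𝔯(K ∪ K'), 1} ≤ 2 √(32 r/ρ₀)` for all `r ≥ 0`;
* `min_log_conformalRadius_sub_log_le_of_subset_union` — the LSW shape: for hulls
  `K ⊆ K₂ ⊆ K ∪ B̄(ζ, r)` with `|ζ| ≥ 1` and `𝔯(K) ≥ ρ₀ > 0`,
  `min{log 𝔯(K) - log 𝔯(K₂), 1} ≤ 2 √(32 r/ρ₀)` (monotonicity of `𝔯`, `conformalRadius_mono`).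

Compared with LSW's `(diam Q')²` the exponent is only `1/2`, but no connectedness of `K'`, no
harmonic measure and no Riemann map is used. No new definitions, no named facts.

## References

* G. F. Lawler, O. Schramm, W. Werner, *One-arm exponent for critical 2D percolation*, Electron.
  J. Probab. 7 (2002), no. 2, proof of Lemma 2.3, (2.15)–(2.16) (p. 7) [LawlerSchrammWernerEJP2002].
* G. F. Lawler, *Conformally invariant processes in the plane*, AMS (2005), Thm. 3.17, Cor. 3.19
  [Lawler2008].
* Ch. Pommerenke, *Boundary Behaviour of Conformal Maps*, Springer (1992), Thm. 1.3
  [PommerenkeBBCM1992].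

## Mathlib / tree

Tree: `koebeQuarter_holds`, `AreaThm.rescale_ball`, `AreaThm.distortion_le_norm_deriv`,
`IsUnivalentInto.norm_deriv_le_conformalRadius`, `conformalRadius_mono`, `conformalRadius_nonneg`,
`SCV.deriv_ne_zero_of_injOn`. Mathlib: `exists_lt_of_lt_csSup`, `le_of_forall_pos_lt_add`,
`Metric.continuous_iff`, `Real.log_le_sub_one_of_pos`.
-/

noncomputable section

open Metric Set Filter Topology

namespace Literature.Analysis.Complex

variable {f φ : ℂ → ℂ} {K K' K₂ : Set ℂ} {ζ : ℂ} {r : ℝ}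

/-! ### Koebe's quarter theorem at an arbitrary point, and the distance to omitted values -/

/-- **Koebe's quarter theorem at an arbitrary point of the disc**: for `f` holomorphic and
injective on `𝔻` and `|z| < 1`, `B(f(z), |f'(z)| (1 - |z|)/4) ⊆ f(𝔻)` — Koebe's theorem for
`w ↦ f(z + (1 - |z|) w)`, whose derivative at `0` is `(1 - |z|) f'(z)`.
[cite: Lawler2008, Thm. 3.17 and Cor. 3.19 (pp. 62–63)] -/
theorem ball_subset_image_of_norm_lt_one (hf : DifferentiableOn ℂ f (ball 0 1))
    (hinj : InjOn f (ball 0 1)) {z : ℂ} (hz : ‖z‖ < 1) :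
    ball (f z) (‖deriv f z‖ * (1 - ‖z‖) / 4) ⊆ f '' ball 0 1 := by
  set R : ℝ := 1 - ‖z‖ with hR
  have hR0 : 0 < R := by rw [hR]; linarith
  have hsub : ball z R ⊆ ball (0 : ℂ) 1 := by
    intro w hw
    rw [mem_ball, dist_eq_norm] at hw
    rw [mem_ball_zero_iff]
    calc ‖w‖ = ‖(w - z) + z‖ := by rw [sub_add_cancel]
      _ ≤ ‖w - z‖ + ‖z‖ := norm_add_le _ _
      _ < R + ‖z‖ := by linarith
      _ = 1 := by rw [hR]; ring
  obtain ⟨hFd, hFinj, hFderiv⟩ := AreaThm.rescale_ball hR0 (hf.mono hsub) (hinj.mono hsub)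
  have hK := koebeQuarter_holds _ hFd hFinj
  have hFd0 : deriv (fun ζ : ℂ ↦ f (z + R * ζ)) 0 = R * deriv f z := by
    rw [hFderiv 0 (mem_ball_self one_pos)]; simp
  simp only [mul_zero, add_zero] at hK
  rw [hFd0, norm_mul, Complex.norm_real, Real.norm_eq_abs, abs_of_pos hR0] at hK
  intro w hw
  have hw' : w ∈ ball (f z) (R * ‖deriv f z‖ / 4) := by
    rw [mem_ball] at hw ⊢
    calc dist w (f z) < ‖deriv f z‖ * R / 4 := hw
      _ = R * ‖deriv f z‖ / 4 := by rw [mul_comm ‖deriv f z‖ R]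
  obtain ⟨ζ', hζ', rfl⟩ := hK hw'
  refine ⟨z + R * ζ', hsub ?_, rfl⟩
  rw [mem_ball_zero_iff] at hζ'
  rw [mem_ball, dist_eq_norm, add_sub_cancel_left, norm_mul, Complex.norm_real, Real.norm_eq_abs,
    abs_of_pos hR0]
  calc R * ‖ζ'‖ < R * 1 := by gcongr
    _ = R := mul_one R

/-- **Distance to omitted values**: for `f` holomorphic and injective on `𝔻`, `|z| < 1` and
`ζ ∉ f(𝔻)`, `|f'(0)| (1 - |z|)²/32 ≤ |f(z) - ζ|`: Koebe's quarter theorem at `z` gives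
`|f(z) - ζ| ≥ |f'(z)| (1 - |z|)/4`, and the distortion theorem
`|f'(z)| ≥ |f'(0)| (1 - |z|)/(1 + |z|)³ ≥ |f'(0)| (1 - |z|)/8`.
[cite: PommerenkeBBCM1992, Thm. 1.3] [cite: Lawler2008, Thm. 3.17 (p. 62)] -/
theorem mul_sq_le_dist_of_notMem_image (hf : DifferentiableOn ℂ f (ball 0 1))
    (hinj : InjOn f (ball 0 1)) {z : ℂ} (hz : ‖z‖ < 1) (hζ : ζ ∉ f '' ball 0 1) :
    ‖deriv f 0‖ * (1 - ‖z‖) ^ 2 / 32 ≤ dist (f z) ζ := by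
  have h1 : ‖deriv f z‖ * (1 - ‖z‖) / 4 ≤ dist (f z) ζ := by
    by_contra h
    push Not at h
    exact hζ (ball_subset_image_of_norm_lt_one hf hinj hz (by rw [mem_ball, dist_comm]; exact h))
  have h2 := AreaThm.distortion_le_norm_deriv hf hinj hz
  have hz0 : 0 ≤ ‖z‖ := norm_nonneg z
  have hz1 : 0 < 1 - ‖z‖ := by linarith
  have h3 : (1 - ‖z‖) / 8 ≤ (1 - ‖z‖) / (1 + ‖z‖) ^ 3 := by
    apply div_le_div_of_nonneg_left hz1.le (by positivity)
    have h12 : 1 + ‖z‖ ≤ 2 := by linarith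
    have h8 : (1 + ‖z‖) ^ 3 ≤ 2 ^ 3 := pow_le_pow_left₀ (by positivity) h12 3
    linarith
  have h4 : ‖deriv f 0‖ * ((1 - ‖z‖) / 8) ≤ ‖deriv f z‖ :=
    (mul_le_mul_of_nonneg_left h3 (norm_nonneg _)).trans h2
  have h5 : ‖deriv f 0‖ * ((1 - ‖z‖) / 8) * ((1 - ‖z‖) / 4) ≤ ‖deriv f z‖ * ((1 - ‖z‖) / 4) :=
    mul_le_mul_of_nonneg_right h4 (by positivity)
  calc ‖deriv f 0‖ * (1 - ‖z‖) ^ 2 / 32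
      = ‖deriv f 0‖ * ((1 - ‖z‖) / 8) * ((1 - ‖z‖) / 4) := by ring
    _ ≤ ‖deriv f z‖ * ((1 - ‖z‖) / 4) := h5
    _ = ‖deriv f z‖ * (1 - ‖z‖) / 4 := by ring
    _ ≤ dist (f z) ζ := h1

/-! ### Rescaled admissible maps avoid a small boundary ball -/

/-- The derivative of an admissible map at `0` is non-zero. [folklore] -/
theorem IsUnivalentInto.norm_deriv_pos (hφ : IsUnivalentInto K φ) : 0 < ‖deriv φ 0‖ :=
  norm_pos_iff.2 (SCV.deriv_ne_zero_of_injOn hφ.differentiableOn isOpen_ball hφ.injOn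
    (mem_ball_self one_pos))

/-- A point `ζ` with `|ζ| ≥ 1` is not a value of an admissible map (whose image lies in `𝔻`).
[folklore] -/
theorem IsUnivalentInto.notMem_image (hφ : IsUnivalentInto K φ) (hζ : 1 ≤ ‖ζ‖) :
    ζ ∉ φ '' ball 0 1 := by
  rintro ⟨z, hz, rfl⟩
  have := hφ.mapsTo_ball hz
  rw [mem_ball_zero_iff] at this
  linarith

/-- The derivative at `0` of the rescaled map `w ↦ φ(c w)` is `c φ'(0)` (for `φ` differentiable
at `0`). [folklore] -/
theorem deriv_rescale (hφ : DifferentiableOn ℂ φ (ball 0 1)) (c : ℂ) :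
    deriv (fun w : ℂ ↦ φ (c * w)) 0 = c * deriv φ 0 := by
  have hd : HasDerivAt φ (deriv φ 0) (c * 0) := by
    rw [mul_zero]
    exact (hφ.differentiableAt (isOpen_ball.mem_nhds (mem_ball_self one_pos))).hasDerivAt
  have hl : HasDerivAt (fun w : ℂ ↦ c * w) c 0 := by
    simpa using (hasDerivAt_id (0 : ℂ)).const_mul c
  have hcomp : HasDerivAt (fun w : ℂ ↦ φ (c * w)) (deriv φ 0 * c) 0 := hd.comp 0 hl
  rw [hcomp.deriv, mul_comm]

/-- `|deriv (w ↦ φ((1 - s) w)) 0| = (1 - s) |φ'(0)|` for `s ≤ 1`. [folklore] -/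
theorem norm_deriv_rescale (hφ : DifferentiableOn ℂ φ (ball 0 1)) {s : ℝ} (hs : s ≤ 1) :
    ‖deriv (fun w : ℂ ↦ φ (((1 - s : ℝ) : ℂ) * w)) 0‖ = (1 - s) * ‖deriv φ 0‖ := by
  rw [deriv_rescale hφ, norm_mul, Complex.norm_real, Real.norm_eq_abs, abs_of_nonneg (by linarith)]

/-- **Rescaled admissible maps avoid a small boundary ball.** If `φ` is admissible for `K`,
`|ζ| ≥ 1`, `K' ⊆ B̄(ζ, r)`, `0 ≤ s < 1` and `32 r ≤ |φ'(0)| s²`, then `w ↦ φ((1 - s) w)` is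
admissible for `K ∪ K'`: for `|w| < 1` the point `z = (1 - s) w` has `1 - |z| > s`, so
`|φ(z) - ζ| ≥ |φ'(0)| (1 - |z|)²/32 > |φ'(0)| s²/32 ≥ r` (`mul_sq_le_dist_of_notMem_image`,
`ζ ∉ φ(𝔻) ⊆ 𝔻`). [cite: LawlerSchrammWernerEJP2002, proof of Lemma 2.3 (p. 7)]
[cite: PommerenkeBBCM1992, Thm. 1.3] -/
theorem IsUnivalentInto.rescale_union (hφ : IsUnivalentInto K φ) (hζ : 1 ≤ ‖ζ‖)
    (hK' : K' ⊆ closedBall ζ r) {s : ℝ} (hs0 : 0 ≤ s) (hs1 : s < 1)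
    (hrs : 32 * r ≤ ‖deriv φ 0‖ * s ^ 2) :
    IsUnivalentInto (K ∪ K') (fun w : ℂ ↦ φ (((1 - s : ℝ) : ℂ) * w)) := by
  have hc0 : ((1 - s : ℝ) : ℂ) ≠ 0 := Complex.ofReal_ne_zero.2 (by linarith)
  have hnc : ‖((1 - s : ℝ) : ℂ)‖ = 1 - s := by
    rw [Complex.norm_real, Real.norm_eq_abs, abs_of_nonneg (by linarith)]
  -- the scaled point lies in the smaller disc
  have hzn : ∀ w ∈ ball (0 : ℂ) 1, ‖((1 - s : ℝ) : ℂ) * w‖ < 1 - s := by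
    intro w hw
    rw [mem_ball_zero_iff] at hw
    rw [norm_mul, hnc]
    calc (1 - s) * ‖w‖ < (1 - s) * 1 := mul_lt_mul_of_pos_left hw (by linarith)
      _ = 1 - s := mul_one _
  have hmaps : MapsTo (fun w : ℂ ↦ ((1 - s : ℝ) : ℂ) * w) (ball 0 1) (ball 0 1) := fun w hw ↦ by
    rw [mem_ball_zero_iff]; linarith [hzn w hw]
  refine ⟨?_, ?_, ?_, ?_⟩
  · exact hφ.differentiableOn.comp ((differentiable_id.const_mul _).differentiableOn) hmaps
  · intro w₁ h₁ w₂ h₂ heq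
    have := hφ.injOn (hmaps h₁) (hmaps h₂) heq
    exact mul_left_cancel₀ hc0 this
  · show φ (((1 - s : ℝ) : ℂ) * 0) = 0
    simpa using hφ.map_zero
  · intro w hw
    set z : ℂ := ((1 - s : ℝ) : ℂ) * w with hz
    have hz1 : ‖z‖ < 1 - s := hzn w hw
    have hzb : z ∈ ball (0 : ℂ) 1 := mem_ball_zero_iff.2 (by linarith)
    refine ⟨(hφ.mapsTo hzb).1, ?_⟩
    rintro (hK | hK'')
    · exact (hφ.mapsTo hzb).2 hK
    · have hdist : dist (φ z) ζ ≤ r := mem_closedBall.1 (hK' hK'')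
      have hlow := mul_sq_le_dist_of_notMem_image hφ.differentiableOn hφ.injOn
        (by linarith : ‖z‖ < 1) (hφ.notMem_image hζ)
      have hpos := hφ.norm_deriv_pos
      have hsq : s ^ 2 < (1 - ‖z‖) ^ 2 := by
        have : s < 1 - ‖z‖ := by linarith
        nlinarith
      have : ‖deriv φ 0‖ * s ^ 2 < ‖deriv φ 0‖ * (1 - ‖z‖) ^ 2 := mul_lt_mul_of_pos_left hsq hpos
      linarith

/-! ### The deficit bound -/

/-- **Deficit bound, for one admissible map.** If `φ` is admissible for `K`, `|ζ| ≥ 1`, `r ≥ 0`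
and `K' ⊆ B̄(ζ, r)`, then `|φ'(0)| - √(32 r |φ'(0)|) ≤ 𝔯(K ∪ K')`: with `ρ = |φ'(0)|`, if
`ρ ≤ 32 r` the left side is `≤ 0`; otherwise `s = √(32 r/ρ) < 1` in
`IsUnivalentInto.rescale_union`, and `(1 - s) ρ = ρ - √(32 r ρ)`.
[cite: LawlerSchrammWernerEJP2002, proof of Lemma 2.3, (2.15)–(2.16) (p. 7)]
[cite: PommerenkeBBCM1992, Thm. 1.3] -/
theorem IsUnivalentInto.sub_sqrt_le_conformalRadius_union (hφ : IsUnivalentInto K φ)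
    (hζ : 1 ≤ ‖ζ‖) (hr : 0 ≤ r) (hK' : K' ⊆ closedBall ζ r) :
    ‖deriv φ 0‖ - Real.sqrt (32 * r * ‖deriv φ 0‖) ≤ conformalRadius (K ∪ K') := by
  set ρ : ℝ := ‖deriv φ 0‖ with hρdef
  have hρ : 0 < ρ := hφ.norm_deriv_pos
  by_cases h32 : ρ ≤ 32 * r
  · have hle : ρ ≤ Real.sqrt (32 * r * ρ) :=
      calc ρ = Real.sqrt (ρ ^ 2) := (Real.sqrt_sq hρ.le).symm
        _ ≤ Real.sqrt (32 * r * ρ) := Real.sqrt_le_sqrt (by nlinarith)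
    linarith [conformalRadius_nonneg (K ∪ K')]
  · push Not at h32
    set s : ℝ := Real.sqrt (32 * r / ρ) with hsdef
    have hs0 : 0 ≤ s := Real.sqrt_nonneg _
    have hs2 : s ^ 2 = 32 * r / ρ := Real.sq_sqrt (by positivity)
    have hs1 : s < 1 := by
      have h1 : 32 * r / ρ < 1 := (div_lt_one hρ).2 h32
      have : s ^ 2 < 1 := by rw [hs2]; exact h1
      nlinarith
    have hcond : 32 * r ≤ ‖deriv φ 0‖ * s ^ 2 := by
      rw [hs2, ← hρdef, mul_div_cancel₀ _ hρ.ne']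
    have hψ := hφ.rescale_union hζ hK' hs0 hs1 hcond
    have hb := hψ.norm_deriv_le_conformalRadius
    rw [norm_deriv_rescale hφ.differentiableOn hs1.le, ← hρdef] at hb
    have hsρ : s * ρ = Real.sqrt (32 * r * ρ) := by
      have h1 : s * ρ = Real.sqrt (32 * r / ρ) * Real.sqrt (ρ ^ 2) := by
        rw [Real.sqrt_sq hρ.le]
      rw [h1, ← Real.sqrt_mul (by positivity)]
      congr 1
      field_simp
    nlinarith [hb, hsρ]

/-- Approximating the extremal conformal radius by admissible maps: if `0 ≤ b < 𝔯(K)` there is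
an admissible `φ` with `|φ'(0)| > b`. [folklore] -/
theorem exists_isUnivalentInto_of_lt {b : ℝ} (hb0 : 0 ≤ b) (hb : b < conformalRadius K) :
    ∃ φ : ℂ → ℂ, IsUnivalentInto K φ ∧ b < ‖deriv φ 0‖ := by
  have hne : (insert 0 (conformalRadiusSet K)).Nonempty := ⟨0, mem_insert _ _⟩
  obtain ⟨x, hx, hbx⟩ := exists_lt_of_lt_csSup hne hb
  rcases hx with rfl | ⟨φ, hφ, rfl⟩
  · exact absurd hbx (not_lt.2 hb0)
  · exact ⟨φ, hφ, hbx⟩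

/-- **Deficit bound.** For `|ζ| ≥ 1`, `r ≥ 0` and `K' ⊆ B̄(ζ, r)`:
`𝔯(K) - √(32 r 𝔯(K)) ≤ 𝔯(K ∪ K')` — the bound for one admissible map and the continuity of
`ρ ↦ ρ - √(32 r ρ)` at `ρ = 𝔯(K) = sup |φ'(0)|`. A harmonic-measure-free substitute (exponent
`1/2` in `r`) for LSW's (2.15)–(2.16). [cite: LawlerSchrammWernerEJP2002, proof of Lemma 2.3, (2.15)–(2.16) (p. 7)]
[cite: PommerenkeBBCM1992, Thm. 1.3] -/
theorem sub_sqrt_le_conformalRadius_union (hζ : 1 ≤ ‖ζ‖) (hr : 0 ≤ r)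
    (hK' : K' ⊆ closedBall ζ r) :
    conformalRadius K - Real.sqrt (32 * r * conformalRadius K) ≤ conformalRadius (K ∪ K') := by
  set g : ℝ → ℝ := fun ρ ↦ ρ - Real.sqrt (32 * r * ρ) with hgdef
  have hgc : Continuous g :=
    continuous_id.sub ((continuous_const.mul continuous_id).sqrt)
  rcases eq_or_lt_of_le (conformalRadius_nonneg K) with h0 | hpos
  · rw [← h0, mul_zero, Real.sqrt_zero, sub_zero]
    exact conformalRadius_nonneg _
  refine le_of_forall_pos_lt_add fun ε hε ↦ ?_
  obtain ⟨δ, hδ, hδε⟩ := Metric.continuous_iff.1 hgc (conformalRadius K) ε hε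
  obtain ⟨φ, hφ, hlt⟩ := exists_isUnivalentInto_of_lt (K := K)
    (b := max 0 (conformalRadius K - δ)) (le_max_left _ _) (max_lt hpos (by linarith))
  have hle := hφ.norm_deriv_le_conformalRadius
  have hd : dist ‖deriv φ 0‖ (conformalRadius K) < δ := by
    rw [Real.dist_eq, abs_sub_lt_iff]
    constructor <;> linarith [le_max_right 0 (conformalRadius K - δ)]
  have h1 := hδε _ hd
  rw [Real.dist_eq, abs_sub_lt_iff] at h1
  have h2 := hφ.sub_sqrt_le_conformalRadius_union hζ hr hK'
  have h3 : g ‖deriv φ 0‖ = ‖deriv φ 0‖ - Real.sqrt (32 * r * ‖deriv φ 0‖) := rfl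
  have h4 : g (conformalRadius K) = conformalRadius K - Real.sqrt (32 * r * conformalRadius K) := rfl
  linarith [h1.1, h1.2]

/-- **Deficit bound, ratio form.** For `|ζ| ≥ 1`, `r ≥ 0`, `K' ⊆ B̄(ζ, r)` and
`0 < ρ₀ ≤ 𝔯(K)`: `(1 - √(32 r/ρ₀)) 𝔯(K) ≤ 𝔯(K ∪ K')`.
[cite: LawlerSchrammWernerEJP2002, proof of Lemma 2.3, (2.15)–(2.16) (p. 7)] -/
theorem one_sub_sqrt_mul_le_conformalRadius_union (hζ : 1 ≤ ‖ζ‖) (hr : 0 ≤ r)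
    (hK' : K' ⊆ closedBall ζ r) {ρ₀ : ℝ} (hρ₀ : 0 < ρ₀) (hρK : ρ₀ ≤ conformalRadius K) :
    (1 - Real.sqrt (32 * r / ρ₀)) * conformalRadius K ≤ conformalRadius (K ∪ K') := by
  have h := sub_sqrt_le_conformalRadius_union (K := K) hζ hr hK'
  have hR0 : 0 ≤ conformalRadius K := conformalRadius_nonneg K
  have hsq : Real.sqrt (32 * r * conformalRadius K) ≤ Real.sqrt (32 * r / ρ₀) * conformalRadius K := by
    have h1 : Real.sqrt (32 * r / ρ₀) * conformalRadius K =
        Real.sqrt (32 * r / ρ₀ * conformalRadius K ^ 2) := by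
      rw [Real.sqrt_mul (by positivity), Real.sqrt_sq hR0]
    rw [h1]
    apply Real.sqrt_le_sqrt
    rw [div_mul_eq_mul_div, le_div_iff₀ hρ₀]
    have : 32 * r * conformalRadius K * ρ₀ ≤ 32 * r * conformalRadius K * conformalRadius K :=
      mul_le_mul_of_nonneg_left hρK (by positivity)
    nlinarith
  nlinarith

/-- **Deficit bound, logarithmic form.** For `|ζ| ≥ 1`, `r ≥ 0`, `K' ⊆ B̄(ζ, r)`,
`0 < ρ₀ ≤ 𝔯(K)` and `32 r/ρ₀ ≤ 1/4`: `log 𝔯(K) - log 𝔯(K ∪ K') ≤ 2 √(32 r/ρ₀)`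
(`-log(1 - x) ≤ x/(1 - x) ≤ 2x` for `x = √(32 r/ρ₀) ≤ 1/2`).
[cite: LawlerSchrammWernerEJP2002, proof of Lemma 2.3, (2.15)–(2.16) (p. 7)] -/
theorem log_conformalRadius_sub_log_union_le (hζ : 1 ≤ ‖ζ‖) (hr : 0 ≤ r)
    (hK' : K' ⊆ closedBall ζ r) {ρ₀ : ℝ} (hρ₀ : 0 < ρ₀) (hρK : ρ₀ ≤ conformalRadius K)
    (hsmall : 32 * r / ρ₀ ≤ 1 / 4) :
    Real.log (conformalRadius K) - Real.log (conformalRadius (K ∪ K')) ≤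
      2 * Real.sqrt (32 * r / ρ₀) := by
  set x : ℝ := Real.sqrt (32 * r / ρ₀) with hxdef
  have hx0 : 0 ≤ x := Real.sqrt_nonneg _
  have hx2 : x ≤ 1 / 2 := by
    rw [hxdef, show (1 / 2 : ℝ) = Real.sqrt (1 / 4) by
      rw [show (1 / 4 : ℝ) = (1 / 2) ^ 2 by norm_num, Real.sqrt_sq (by norm_num)]]
    exact Real.sqrt_le_sqrt hsmall
  have hRpos : 0 < conformalRadius K := hρ₀.trans_le hρK
  have hratio := one_sub_sqrt_mul_le_conformalRadius_union hζ hr hK' hρ₀ hρK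
  rw [← hxdef] at hratio
  have h1x : 0 < 1 - x := by linarith
  have hUpos : 0 < conformalRadius (K ∪ K') := lt_of_lt_of_le (by positivity) hratio
  have hlog1 : Real.log ((1 - x) * conformalRadius K) ≤ Real.log (conformalRadius (K ∪ K')) :=
    Real.log_le_log (by positivity) hratio
  rw [Real.log_mul h1x.ne' hRpos.ne'] at hlog1
  -- `-log(1 - x) ≤ (1 - x)⁻¹ - 1 ≤ 2x`
  have hlog2 : -Real.log (1 - x) ≤ (1 - x)⁻¹ - 1 := by
    rw [← Real.log_inv]
    exact Real.log_le_sub_one_of_pos (inv_pos.2 h1x)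
  have hinv : (1 - x)⁻¹ ≤ 1 + 2 * x := by
    rw [inv_le_iff_one_le_mul₀ h1x]
    nlinarith
  linarith

/-- **Deficit bound, truncated logarithmic form.** For `|ζ| ≥ 1`, `r ≥ 0`, `K' ⊆ B̄(ζ, r)` and
`0 < ρ₀ ≤ 𝔯(K)`: `min{log 𝔯(K) - log 𝔯(K ∪ K'), 1} ≤ 2 √(32 r/ρ₀)` (for `32 r/ρ₀ > 1/4` the
right side exceeds `1`). This is the harmonic-measure-free form of LSW's
"`min{log 𝔯(θ) - log 𝔯(2π), 1} ≤ c (diam Q')²`", with exponent `1/2`.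
[cite: LawlerSchrammWernerEJP2002, proof of Lemma 2.3, (2.15)–(2.16) (p. 7)] -/
theorem min_log_conformalRadius_sub_log_union_le (hζ : 1 ≤ ‖ζ‖) (hr : 0 ≤ r)
    (hK' : K' ⊆ closedBall ζ r) {ρ₀ : ℝ} (hρ₀ : 0 < ρ₀) (hρK : ρ₀ ≤ conformalRadius K) :
    min (Real.log (conformalRadius K) - Real.log (conformalRadius (K ∪ K'))) 1 ≤
      2 * Real.sqrt (32 * r / ρ₀) := by
  by_cases hsmall : 32 * r / ρ₀ ≤ 1 / 4
  · exact (min_le_left _ _).trans (log_conformalRadius_sub_log_union_le hζ hr hK' hρ₀ hρK hsmall)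
  · push Not at hsmall
    have : (1 / 2 : ℝ) < Real.sqrt (32 * r / ρ₀) := by
      rw [show (1 / 2 : ℝ) = Real.sqrt (1 / 4) by
        rw [show (1 / 4 : ℝ) = (1 / 2) ^ 2 by norm_num, Real.sqrt_sq (by norm_num)]]
      exact Real.sqrt_lt_sqrt (by norm_num) hsmall
    linarith [min_le_right (Real.log (conformalRadius K) - Real.log (conformalRadius (K ∪ K'))) 1]

/-- **The LSW shape of the deficit bound.** For hulls `K ⊆ K₂ ⊆ K ∪ B̄(ζ, r)` with `|ζ| ≥ 1`,
`r ≥ 0` and `𝔯(K) ≥ ρ₀ > 0` (in LSW: `K = Q(θ)`, `K₂ = Q(2π) = Q(θ) ∪ Q'`, `Q'` within distance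
`r` of the boundary point `1`, on the event `𝔯(θ) ≥ ρ₀`):
`min{log 𝔯(K) - log 𝔯(K₂), 1} ≤ 2 √(32 r/ρ₀)`, and `(1 - √(32 r/ρ₀)) 𝔯(K) ≤ 𝔯(K₂) ≤ 𝔯(K)`.
[cite: LawlerSchrammWernerEJP2002, proof of Lemma 2.3, (2.15)–(2.16) (p. 7)] -/
theorem min_log_conformalRadius_sub_log_le_of_subset_union (hζ : 1 ≤ ‖ζ‖) (hr : 0 ≤ r)
    (hKK₂ : K ⊆ K₂) (hK₂ : K₂ ⊆ K ∪ closedBall ζ r) {ρ₀ : ℝ} (hρ₀ : 0 < ρ₀)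
    (hρK : ρ₀ ≤ conformalRadius K) :
    min (Real.log (conformalRadius K) - Real.log (conformalRadius K₂)) 1 ≤
        2 * Real.sqrt (32 * r / ρ₀) ∧
      (1 - Real.sqrt (32 * r / ρ₀)) * conformalRadius K ≤ conformalRadius K₂ ∧
      conformalRadius K₂ ≤ conformalRadius K := by
  have hmono₁ : conformalRadius (K ∪ closedBall ζ r) ≤ conformalRadius K₂ := conformalRadius_mono hK₂
  have hmono₂ : conformalRadius K₂ ≤ conformalRadius K := conformalRadius_mono hKK₂
  have hratio := one_sub_sqrt_mul_le_conformalRadius_union (K := K) hζ hr Subset.rfl hρ₀ hρK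
  refine ⟨?_, hratio.trans hmono₁, hmono₂⟩
  by_cases hsmall : 32 * r / ρ₀ ≤ 1 / 4
  · have hlog := log_conformalRadius_sub_log_union_le (K := K) hζ hr Subset.rfl hρ₀ hρK hsmall
    have hx2 : Real.sqrt (32 * r / ρ₀) ≤ 1 / 2 := by
      rw [show (1 / 2 : ℝ) = Real.sqrt (1 / 4) by
        rw [show (1 / 4 : ℝ) = (1 / 2) ^ 2 by norm_num, Real.sqrt_sq (by norm_num)]]
      exact Real.sqrt_le_sqrt hsmall
    have hUpos : 0 < conformalRadius (K ∪ closedBall ζ r) :=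
      lt_of_lt_of_le (by nlinarith [hρ₀.trans_le hρK]) hratio
    have hlogmono : Real.log (conformalRadius (K ∪ closedBall ζ r)) ≤ Real.log (conformalRadius K₂) :=
      Real.log_le_log hUpos hmono₁
    refine (min_le_left _ _).trans ?_
    linarith
  · push Not at hsmall
    have : (1 / 2 : ℝ) < Real.sqrt (32 * r / ρ₀) := by
      rw [show (1 / 2 : ℝ) = Real.sqrt (1 / 4) by
        rw [show (1 / 4 : ℝ) = (1 / 2) ^ 2 by norm_num, Real.sqrt_sq (by norm_num)]]
      exact Real.sqrt_lt_sqrt (by norm_num) hsmall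
    linarith [min_le_right (Real.log (conformalRadius K) - Real.log (conformalRadius K₂)) 1]

end Literature.Analysis.Complex
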